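import Summits.QuantumFields.BalabanUV.Beta.WilsonBiStencilWardFrame
import Literature.MathematicalPhysics.QuantumFieldTheory.Balaban1983to89.Beta.WilsonVertex2Sym

/-!
# The second-order background-gauge Ward identity of the Wilson plaquette jets, ENTRYWISE WITH COLOUR, on every finite lattice — file 2
# of the (T2-S₂) Wilson table law (β sub-cell, row D1, (L4) W-side, Ward twin of (W-LET-S₂)₀; D1 formalisation swarm seat
# `b2b-balaban-beta-d1-formalise-leaf-09`, gen 4; CLAIM «D1-hW-L4-W22-TABLE-WARD», file 2)

HONEST FRAMING (cell charter, verbatim): «discharging `BetaPertH` makes Bałaban's UV stability UNCONDITIONAL — a real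
constructive-QFT result; it is NOT the continuum limit and NOT the Clay problem.»  HONEST DEPENDENCY (cell records, verbatim):
«continuum YM on T⁴ ⇐ BetaPertH ∧ nine spine estimates (0/9 proved); BetaPertH ⇐ (D1) ∧ (D4) ∧ CAP+tail; G-an2-4 gates asym, D1 and
NE2/3/4.»  DERIVED cell leaf: finite-dimensional algebra over an arbitrary finite abelian lattice, no estimate, no limit, nothing cited —
every statement is kernel-proved here ([folklore]); no `[cite:]` tag, no `def`, no `def … : Prop`.  By itself this file instantiates NO
binder of the β-function wall.  NOT D1, NOT `BetaPertH`, NOT continuum, NOT Clay.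
ABSOLUTE RULE (cell charter, verbatim): «No internally-minted statement may enter as a cited fact. Every hypothesis is either
kernel-proved in this package or a verbatim quotation of a PUBLISHED theorem with page reference. The manuscript(s) under audit are
NOT citable for their own disputed steps — they are the thing under adjudication; programme-internal (2001/route/tribunal) claims are
never citable.»

## What

File 1 (`WilsonBiStencilWardFrame.bgWard22_quadForm`) is the order-`(W², B¹)` background-gauge Ward identity as a law of QUADRATIC FORMS in
the fluctuation `v`, for ANY background `B`, in the rotated-letter family `T = rotFam t Y y`.  Here the background is ONE BOND LETTER
`B = bondLetter u′ κ′ Y′` and the spare summand of the family is `y = ![Y′, Y]`, so that BOTH backgrounds of the identity are coordinate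
fields of `T` (§1: `field_single_spare₀ : field T δ_{(u′,(⋆0,κ′))} = bondLetter u′ κ′ Y′`, `field_gaugeVec : field T g_ℓ = W₀(ℓ • Y)`);
an3's `WilsonVertex2Sym.hess22_polar` then gives THE POLARISED HESSIAN THROUGH THE TWO-BOND VERTICES (§2 `polHess_bondLetter`):
`hess22 T (B + W₀) − hess22 T B − hess22 T W₀ = Σ_x Σ_μ (ℓ x − ℓ (x + e_μ)) • (wilsonVertex₂ T P′ (x,(⋆1,μ)) + wilsonVertex₂ T (x,(⋆1,μ)) P′)`,
`P′ = (u′,(⋆0,κ′))` — the DIVERGENCE of the two-bond vertex in its second background slot, weighted by the site profile.  The two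
`(2,1)` operators collapse onto the bond: `wilsonVertexOp e (adM τ T (bondLetter u′ κ′ Y′ ·)) = wilsonVertex₁ e u′ κ′ (adM τ T Y′)`
(`wilsonVertexOp_bondLetter`) and the rotated background is `(ℓ u′ + ℓ (u′ + e_κ′)) • wilsonVertex₁ e u′ κ′ (adM τ T [Y,Y′])`
(`wilsonVertexOp_rot_bondLetter`).  §3 pulls the three quadratic forms of file 1 back to the ORIGINAL index `Λ × (C × D)` (the forms in
`emb₀ v`, `emb₁ (ℓ ⊙ v)` are forms in `v` with the `(in₀,in₀)`, `(in₀,in₁)`, `(in₁,in₀)` colour blocks as matrices: `quadForm_emb₀_emb₀`,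
`quadForm_emb₀_emb₁`, `quadForm_emb₁_emb₀`) and a quadratic form vanishing identically has vanishing symmetrised matrix
(`entry_add_entry_eq_zero_of_quadForm`).  §4 **`bgWard22_entry_colour`** — THE ENTRYWISE LAW WITH COLOUR: for all fluctuation legs
`P = (x,(a,α))`, `Q = (z,(b,β))`, with `N := 4·H − 4·M − 2·R` read on the blocks,
`N P Q + N Q P = 0`, where `H P Q = Σ_{x′,μ} (ℓ x′ − ℓ(x′+e_μ))·[wV₂ T P′ (x′,⋆1,μ) + wV₂ T (x′,⋆1,μ) P′]((x,in₀ a,α),(z,in₀ b,β))`,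
`M P Q = ℓ z · wV₁(adM T Y′)((x,in₀ a,α),(z,in₁ b,β)) + ℓ x · wV₁(adM T Y′)((x,in₁ a,α),(z,in₀ b,β))`,
`R P Q = (ℓ u′ + ℓ(u′+e_κ′)) · wV₁(adM T [Y,Y′])((x,in₀ a,α),(z,in₀ b,β))`; and **`bgWard22_entry_colour_eval`**: the same with the
`(2,1)` entries EVALUATED by an3's `wilsonVertex₁_apply_eq_mul` — colour numbers `τ(Y′·[t a, [Y, t b]])`, `τ(Y′·[[Y, t a], t b])`,
`τ([Y,Y′]·[t a, t b])` times the SAME colourless stencil `wilsonStencil₀ e u′ κ′ (x,α) (z,β)` (the reading an2's `StepJetData.wEntry` takes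
on `ℤ^{d+1}`) — the commutator-with-the-indicator shape of the hW socket `hS₂` appears through the weights `ℓ z`, `ℓ x` with NO Lie-algebra
completeness and NO Fierz identity.
NOT HERE (file 3, same claim): the evaluation of the `(2,2)` entries by `wilsonVertex₂_apply` into `cmat`-colour numbers × `bondPairTab`,
the fluctuation-colour trace, the transport to `ℤ^{d+1}` and the packed socket form for `wilsonW₂ d (w22 N)` / `wilsonA d`.
Provenance: pub-balaban β sub-cell, D1 formalisation swarm, unit `b2b-balaban-beta-d1-formalise-leaf-09` gen 4, 2026-08-20 (v1); over file 1
and an3's `WilsonVertex2Sym` / `WilsonVertexKron` / `PlaquetteBackground` BY NAME; no existing file touched.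
-/

namespace Summit.QuantumFields.BalabanUV.Beta.WilsonBiStencilWardEntry

open Finset
open scoped BigOperators Matrix
open Literature.MathematicalPhysics.QuantumFieldTheory.Balaban1983to89.Beta
open Literature.MathematicalPhysics.QuantumFieldTheory.Balaban1983to89.Beta.SpinTable (br)
open Literature.MathematicalPhysics.QuantumFieldTheory.Balaban1983to89.Beta.PlaquetteVertex (field adM adM_apply bondLetter)
open Literature.MathematicalPhysics.QuantumFieldTheory.Balaban1983to89.Beta.PlaquetteStencil (wilsonVertex₁)
open Literature.MathematicalPhysics.QuantumFieldTheory.Balaban1983to89.Beta.PlaquetteVertex2Stencil (hess22)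
open Literature.MathematicalPhysics.QuantumFieldTheory.Balaban1983to89.Beta.PlaquetteBackground (wilsonVertexOp)
open Literature.MathematicalPhysics.QuantumFieldTheory.Balaban1983to89.Beta.WilsonWardJets (gaugeDir₀)
open Literature.MathematicalPhysics.QuantumFieldTheory.Balaban1983to89.Beta.WilsonVertexKron (wilsonStencil₀ wilsonVertex₁_apply_eq_mul)
open Literature.MathematicalPhysics.QuantumFieldTheory.Balaban1983to89.Beta.WilsonVertex2Kron (wilsonVertex₂)
open Literature.MathematicalPhysics.QuantumFieldTheory.Balaban1983to89.Beta.WilsonVertex2Sym (hess22_polar dotProduct_mulVec_polar)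
open Summit.QuantumFields.BalabanUV.Beta.WilsonReflectionFrame (adM_smul wilsonVertex₁_smul)
open Summit.QuantumFields.BalabanUV.Beta.WilsonStencilDivergence (siteMul siteMul_apply)
open Summit.QuantumFields.BalabanUV.Beta.WilsonBiStencilWardFrame

/-! ## §1 The two backgrounds as coordinate fields of the extended family `rotFam t Y ![Y′, Y]` -/

section Backgrounds

variable {𝔸 : Type*} [NormedRing 𝔸] [NormedAlgebra ℝ 𝔸]
variable {Λ : Type*} [DecidableEq Λ] [AddCommGroup Λ] {C : Type*} [Fintype C] [DecidableEq C] {D : Type*} [DecidableEq D]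

omit [AddCommGroup Λ] in
/-- [folklore] **THE BOND LETTER IS THE COORDINATE FIELD OF THE DELTA AT THE FIRST SPARE COLOUR**:
`field (rotFam t Y ![Y′, Y]) δ_{(u′,(⋆0,κ′))} = bondLetter u′ κ′ Y′`. -/
theorem field_single_spare₀ (t : C → 𝔸) (Y Y' : 𝔸) (u' : Λ) (κ' : D) :
    field (rotFam t Y ![Y', Y]) (Pi.single (u', (Sum.inr (Sum.inr (0 : Fin 2)), κ')) (1 : ℝ)) = bondLetter u' κ' Y' := by
  funext x k
  simp only [field, bondLetter]
  by_cases h : x = u' ∧ k = κ'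
  · obtain ⟨rfl, rfl⟩ := h
    rw [if_pos ⟨rfl, rfl⟩, Finset.sum_eq_single (Sum.inr (Sum.inr (0 : Fin 2)))]
    · simp [rotFam]
    · intro c _ hc
      rw [Pi.single_eq_of_ne (fun h' => hc (by simpa using h')), zero_smul]
    · intro h'; exact absurd (Finset.mem_univ _) h'
  · rw [if_neg h]
    refine Finset.sum_eq_zero fun c _ => ?_
    rw [Pi.single_eq_of_ne, zero_smul]
    intro h'
    apply h
    simp only [Prod.mk.injEq] at h'
    exact ⟨h'.1, h'.2.2⟩

omit [DecidableEq Λ] [DecidableEq D] in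
/-- [folklore] **THE PURE-GAUGE BACKGROUND IS THE COORDINATE FIELD OF THE SITE-PROFILE DIFFERENCES AT THE SECOND SPARE COLOUR**:
`field (rotFam t Y ![Y′, Y]) g = gaugeDir₀ e (ℓ • Y)`, `g (x,(c,μ)) = [c = ⋆1]·(ℓ x − ℓ (x + e_μ))`. -/
theorem field_gaugeVec (t : C → 𝔸) (Y Y' : 𝔸) (e : D → Λ) (ell : Λ → ℝ) :
    field (rotFam t Y ![Y', Y])
        (fun p : Λ × ((C ⊕ (C ⊕ Fin 2)) × D) => if p.2.1 = Sum.inr (Sum.inr (1 : Fin 2)) then ell p.1 - ell (p.1 + e p.2.2) else 0) =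
      gaugeDir₀ e (fun x => ell x • Y) := by
  funext x k
  simp only [field, gaugeDir₀]
  rw [Finset.sum_eq_single (Sum.inr (Sum.inr (1 : Fin 2)))]
  · simp [rotFam, sub_smul]
  · intro c _ hc; rw [if_neg hc, zero_smul]
  · intro h'; exact absurd (Finset.mem_univ _) h'

end Backgrounds

/-! ## §2 The polarised Hessian through the two-bond vertices; the `(2,1)` operators on one bond -/

section Polar

variable {𝔸 : Type*} [NormedRing 𝔸] [NormedAlgebra ℝ 𝔸]
variable {Λ : Type*} [Fintype Λ] [DecidableEq Λ] [AddCommGroup Λ] {C : Type*} [Fintype C] [DecidableEq C]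
  {D : Type*} [Fintype D] [DecidableEq D]

/-- [folklore] **THE RESPONSE OF THE `(2,2)` HESSIAN TO A PURE-GAUGE BACKGROUND, THROUGH THE TWO-BOND VERTICES**: with
`T = rotFam t Y ![Y′, Y]`, `B = bondLetter u′ κ′ Y′`, `W₀ = gaugeDir₀ e (ℓ • Y)`, `P′ = (u′,(⋆0,κ′))`,
`hess22 T (B + W₀) − hess22 T B − hess22 T W₀`
`  = Σ_x Σ_μ (ℓ x − ℓ(x + e_μ)) • (wilsonVertex₂ T P′ (x,(⋆1,μ)) + wilsonVertex₂ T (x,(⋆1,μ)) P′)`. -/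
theorem polHess_bondLetter (τ : 𝔸 →ₗ[ℝ] ℝ) (t : C → 𝔸) (Y Y' : 𝔸) (e : D → Λ) (u' : Λ) (κ' : D) (ell : Λ → ℝ) :
    hess22 τ (rotFam t Y ![Y', Y]) e (bondLetter u' κ' Y' + gaugeDir₀ e (fun x => ell x • Y))
        - hess22 τ (rotFam t Y ![Y', Y]) e (bondLetter u' κ' Y') - hess22 τ (rotFam t Y ![Y', Y]) e (gaugeDir₀ e (fun x => ell x • Y)) =
      ∑ x : Λ, ∑ μ : D, (ell x - ell (x + e μ)) •
        (wilsonVertex₂ τ (rotFam t Y ![Y', Y]) e (u', (Sum.inr (Sum.inr 0), κ')) (x, (Sum.inr (Sum.inr 1), μ))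
          + wilsonVertex₂ τ (rotFam t Y ![Y', Y]) e (x, (Sum.inr (Sum.inr 1), μ)) (u', (Sum.inr (Sum.inr 0), κ'))) := by
  rw [← field_single_spare₀ t Y Y' u' κ', ← field_gaugeVec t Y Y' e ell, ← field_add, hess22_polar]
  -- the first coordinate sum collapses at `P′`
  rw [Finset.sum_eq_single (u', (Sum.inr (Sum.inr (0 : Fin 2)), κ'))]
  · simp only [Pi.single_eq_same, one_mul]
    rw [Fintype.sum_prod_type]
    refine Finset.sum_congr rfl fun x _ => ?_
    rw [Fintype.sum_prod_type, Finset.sum_eq_single (Sum.inr (Sum.inr (1 : Fin 2)))]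
    · simp only [if_true]
    · intro c _ hc
      simp only [if_neg hc, zero_smul, Finset.sum_const_zero]
    · intro h'; exact absurd (Finset.mem_univ _) h'
  · intro p _ hp
    simp only [Pi.single_eq_of_ne hp, zero_mul, zero_smul, Finset.sum_const_zero]
  · intro h'; exact absurd (Finset.mem_univ _) h'

omit [DecidableEq C] in
/-- [folklore] **THE `(2,1)` OPERATOR OF A ONE-BOND BACKGROUND IS THE ONE-BOND VERTEX**:
`wilsonVertexOp e (adM τ T (bondLetter u′ κ′ Y′ ·)) = wilsonVertex₁ e u′ κ′ (adM τ T Y′)` (any family `T`). -/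
theorem wilsonVertexOp_bondLetter {C' : Type*} [Fintype C'] [DecidableEq C'] (τ : 𝔸 →ₗ[ℝ] ℝ) (T : C' → 𝔸) (e : D → Λ)
    (u' : Λ) (κ' : D) (Y' : 𝔸) :
    wilsonVertexOp e (fun z γ => adM τ T (bondLetter u' κ' Y' z γ)) = wilsonVertex₁ e u' κ' (adM τ T Y') := by
  unfold wilsonVertexOp
  have h0 : ∀ (z : Λ) (γ : D), ¬(z = u' ∧ γ = κ') → wilsonVertex₁ e z γ (adM τ T (bondLetter u' κ' Y' z γ)) = 0 := by
    intro z γ h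
    rw [show bondLetter u' κ' Y' z γ = (0 : ℝ) • Y' by simp [bondLetter, h], adM_smul, wilsonVertex₁_smul, zero_smul]
  rw [Finset.sum_eq_single u']
  · rw [Finset.sum_eq_single κ']
    · simp only [bondLetter, and_self, if_true]
    · intro γ _ hγ; exact h0 u' γ (fun h => hγ h.2)
    · intro h'; exact absurd (Finset.mem_univ _) h'
  · intro z _ hz; exact Finset.sum_eq_zero fun γ _ => h0 z γ (fun h => hz h.1)
  · intro h'; exact absurd (Finset.mem_univ _) h'

omit [DecidableEq C] in
/-- [folklore] **THE ROTATED ONE-BOND BACKGROUND**: for `B = bondLetter u′ κ′ Y′`,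
`wilsonVertexOp e (z γ ↦ adM τ T ((ℓ z + ℓ (z + e γ)) • (Y·B z γ − B z γ·Y)))`
`  = (ℓ u′ + ℓ (u′ + e_κ′)) • wilsonVertex₁ e u′ κ′ (adM τ T (Y·Y′ − Y′·Y))`. -/
theorem wilsonVertexOp_rot_bondLetter {C' : Type*} [Fintype C'] [DecidableEq C'] (τ : 𝔸 →ₗ[ℝ] ℝ) (T : C' → 𝔸) (e : D → Λ)
    (u' : Λ) (κ' : D) (Y Y' : 𝔸) (ell : Λ → ℝ) :
    wilsonVertexOp e (fun z γ => adM τ T ((ell z + ell (z + e γ)) • (Y * bondLetter u' κ' Y' z γ - bondLetter u' κ' Y' z γ * Y))) =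
      (ell u' + ell (u' + e κ')) • wilsonVertex₁ e u' κ' (adM τ T (Y * Y' - Y' * Y)) := by
  have hrot : (fun z γ => adM τ T ((ell z + ell (z + e γ)) • (Y * bondLetter u' κ' Y' z γ - bondLetter u' κ' Y' z γ * Y))) =
      fun z γ => adM τ T (bondLetter u' κ' ((ell u' + ell (u' + e κ')) • (Y * Y' - Y' * Y)) z γ) := by
    funext z γ
    by_cases h : z = u' ∧ γ = κ'
    · obtain ⟨rfl, rfl⟩ := h
      simp [bondLetter]
    · simp [bondLetter, h]
  rw [hrot, wilsonVertexOp_bondLetter, adM_smul, wilsonVertex₁_smul]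

end Polar

/-! ## §3 Pull-back of the three quadratic forms to the fluctuation index, and entries of a vanishing quadratic form -/

section Pullback

variable {Λ : Type*} [Fintype Λ] {C : Type*} [Fintype C] {ι : Type*} [Fintype ι] {D : Type*} [Fintype D]

/-- [folklore] the form in `emb₀ v`, `emb₀ w` is the form of the `(in₀,in₀)` block in `v`, `w`. -/
theorem quadForm_emb₀_emb₀ (H : Matrix (Λ × ((C ⊕ (C ⊕ ι)) × D)) (Λ × ((C ⊕ (C ⊕ ι)) × D)) ℝ) (v w : Λ × (C × D) → ℝ) :
    emb₀ ι v ⬝ᵥ (H *ᵥ emb₀ ι w) =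
      v ⬝ᵥ ((Matrix.of fun P Q : Λ × (C × D) => H (P.1, (Sum.inl P.2.1, P.2.2)) (Q.1, (Sum.inl Q.2.1, Q.2.2))) *ᵥ w) := by
  simp only [dotProduct, Matrix.mulVec, Matrix.of_apply, Fintype.sum_prod_type, Fintype.sum_sum_type, emb₀_inl, emb₀_inr, zero_mul,
    mul_zero, Finset.sum_const_zero, add_zero]

/-- [folklore] the form in `emb₀ v`, `emb₁ w` is the form of the `(in₀,in₁)` block. -/
theorem quadForm_emb₀_emb₁ (H : Matrix (Λ × ((C ⊕ (C ⊕ ι)) × D)) (Λ × ((C ⊕ (C ⊕ ι)) × D)) ℝ) (v w : Λ × (C × D) → ℝ) :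
    emb₀ ι v ⬝ᵥ (H *ᵥ emb₁ ι w) =
      v ⬝ᵥ ((Matrix.of fun P Q : Λ × (C × D) => H (P.1, (Sum.inl P.2.1, P.2.2)) (Q.1, (Sum.inr (Sum.inl Q.2.1), Q.2.2))) *ᵥ w) := by
  simp only [dotProduct, Matrix.mulVec, Matrix.of_apply, Fintype.sum_prod_type, Fintype.sum_sum_type, emb₀_inl, emb₀_inr, emb₁_inl,
    emb₁_inr_inl, emb₁_inr_inr, zero_mul, mul_zero, Finset.sum_const_zero, add_zero, zero_add]

/-- [folklore] the form in `emb₁ w`, `emb₀ v` is the form of the `(in₁,in₀)` block. -/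
theorem quadForm_emb₁_emb₀ (H : Matrix (Λ × ((C ⊕ (C ⊕ ι)) × D)) (Λ × ((C ⊕ (C ⊕ ι)) × D)) ℝ) (v w : Λ × (C × D) → ℝ) :
    emb₁ ι w ⬝ᵥ (H *ᵥ emb₀ ι v) =
      w ⬝ᵥ ((Matrix.of fun P Q : Λ × (C × D) => H (P.1, (Sum.inr (Sum.inl P.2.1), P.2.2)) (Q.1, (Sum.inl Q.2.1, Q.2.2))) *ᵥ v) := by
  simp only [dotProduct, Matrix.mulVec, Matrix.of_apply, Fintype.sum_prod_type, Fintype.sum_sum_type, emb₀_inl, emb₀_inr, emb₁_inl,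
    emb₁_inr_inl, emb₁_inr_inr, zero_mul, mul_zero, Finset.sum_const_zero, add_zero, zero_add]

omit [Fintype ι] in
/-- [folklore] the site-weighted coordinates are the image of the diagonal site-profile matrix. -/
theorem siteMul_eq_mulVec [DecidableEq Λ] [DecidableEq C] [DecidableEq D] (ell : Λ → ℝ) (v : Λ × (C × D) → ℝ) :
    siteMul ell v = (Matrix.diagonal fun P : Λ × (C × D) => ell P.1) *ᵥ v := by
  funext P
  rw [siteMul_apply, Matrix.mulVec_diagonal]

omit [Fintype Λ] [Fintype C] [Fintype ι] [Fintype D] in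
/-- [folklore] **A QUADRATIC FORM VANISHING IDENTICALLY HAS VANISHING SYMMETRISED MATRIX**: `(∀ v, v ⬝ᵥ N v = 0) → N P Q + N Q P = 0`. -/
theorem entry_add_entry_eq_zero_of_quadForm {n : Type*} [Fintype n] [DecidableEq n] (N : Matrix n n ℝ)
    (h : ∀ v : n → ℝ, v ⬝ᵥ (N *ᵥ v) = 0) (P Q : n) : N P Q + N Q P = 0 := by
  have hpol := dotProduct_mulVec_polar N (Pi.single P 1) (Pi.single Q 1)
  rw [h, h, h, sub_zero, sub_zero, Matrix.mulVec_single_one, single_dotProduct, one_mul, Matrix.col_apply, Matrix.add_apply,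
    Matrix.transpose_apply] at hpol
  exact hpol.symm

omit [Fintype Λ] [Fintype C] [Fintype ι] [Fintype D] in
/-- [folklore] **ENTRIES OF THE THREE-FORM SHAPE**: if `c₁·vᵀAv − c₂·(vᵀB₁(ℓ⊙v) + (ℓ⊙v)ᵀB₂v) − c₃·vᵀRv = 0` for every `v`, then the matrix
`N = c₁A − c₂(B₁·diag ℓ + diag ℓ·B₂) − c₃R` has vanishing symmetrised entries. -/
theorem entries_of_threeForms {n : Type*} [Fintype n] [DecidableEq n] (A B₁ B₂ R : Matrix n n ℝ) (ell : n → ℝ) (c₁ c₂ c₃ : ℝ)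
    (h : ∀ v : n → ℝ, c₁ * (v ⬝ᵥ (A *ᵥ v)) - c₂ * (v ⬝ᵥ (B₁ *ᵥ fun i => ell i * v i) + (fun i => ell i * v i) ⬝ᵥ (B₂ *ᵥ v))
      - c₃ * (v ⬝ᵥ (R *ᵥ v)) = 0) (P Q : n) :
    (c₁ * A P Q - c₂ * (B₁ P Q * ell Q + ell P * B₂ P Q) - c₃ * R P Q)
      + (c₁ * A Q P - c₂ * (B₁ Q P * ell P + ell Q * B₂ Q P) - c₃ * R Q P) = 0 := by
  have hq : ∀ v : n → ℝ, v ⬝ᵥ ((c₁ • A - c₂ • (B₁ * Matrix.diagonal ell + Matrix.diagonal ell * B₂) - c₃ • R) *ᵥ v) = 0 := by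
    intro v
    have hd : Matrix.diagonal ell *ᵥ v = fun i => ell i * v i := funext fun i => Matrix.mulVec_diagonal ell v i
    have hd' : v ⬝ᵥ (Matrix.diagonal ell *ᵥ (B₂ *ᵥ v)) = (fun i => ell i * v i) ⬝ᵥ (B₂ *ᵥ v) := by
      simp only [dotProduct, Matrix.mulVec_diagonal]
      exact Finset.sum_congr rfl fun i _ => by ring
    rw [Matrix.sub_mulVec, Matrix.sub_mulVec, Matrix.smul_mulVec, Matrix.smul_mulVec, Matrix.smul_mulVec,
      Matrix.add_mulVec, ← Matrix.mulVec_mulVec, ← Matrix.mulVec_mulVec, hd, dotProduct_sub, dotProduct_sub, dotProduct_smul,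
      dotProduct_smul, dotProduct_smul, dotProduct_add, hd', smul_eq_mul, smul_eq_mul, smul_eq_mul]
    exact h v
  have hPQ := entry_add_entry_eq_zero_of_quadForm _ hq P Q
  simp only [Matrix.sub_apply, Matrix.add_apply, Matrix.smul_apply, smul_eq_mul, Matrix.mul_diagonal, Matrix.diagonal_mul] at hPQ
  linarith

end Pullback

/-! ## §4 The entrywise law with colour -/

section Entry

variable {𝔸 : Type*} [NormedRing 𝔸] [NormedAlgebra ℝ 𝔸]
variable {Λ : Type*} [Fintype Λ] [DecidableEq Λ] [AddCommGroup Λ] {C : Type*} [Fintype C] [DecidableEq C]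
  {D : Type*} [Fintype D] [DecidableEq D]

/-- [folklore] **THE SECOND-ORDER BACKGROUND-GAUGE WARD IDENTITY, ENTRYWISE WITH COLOUR** (see the module docstring): for every finite
lattice `Λ` with frame `e`, normed real algebra `𝔸` with tracial `τ`, letter family `t`, gauge letter `Y`, background bond `(u′, κ′)`
with letter `Y′`, site profile `ℓ`, and all fluctuation legs `P = (x,(a,α))`, `Q = (z,(b,β))`: `N P Q + N Q P = 0` for the matrix
`N = 4·H − 4·M − 2·R` of the three blocks (polarised `(2,2)` Hessian; `(2,1)` vertex between the fluctuation and its conjugate, weighted by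
the profile at the CONJUGATED leg; rotated-letter `(2,1)` vertex). -/
theorem bgWard22_entry_colour (τ : 𝔸 →ₗ[ℝ] ℝ) (hτ : ∀ a b : 𝔸, τ (a * b) = τ (b * a)) (t : C → 𝔸) (Y Y' : 𝔸) (e : D → Λ)
    (u' : Λ) (κ' : D) (ell : Λ → ℝ) (P Q : Λ × (C × D)) :
    let T := rotFam t Y ![Y', Y]
    let N : Matrix (Λ × (C × D)) (Λ × (C × D)) ℝ := Matrix.of fun P Q =>
      4 * (∑ x : Λ, ∑ μ : D, (ell x - ell (x + e μ)) •
          (wilsonVertex₂ τ T e (u', (Sum.inr (Sum.inr 0), κ')) (x, (Sum.inr (Sum.inr 1), μ))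
            + wilsonVertex₂ τ T e (x, (Sum.inr (Sum.inr 1), μ)) (u', (Sum.inr (Sum.inr 0), κ'))))
          (P.1, (Sum.inl P.2.1, P.2.2)) (Q.1, (Sum.inl Q.2.1, Q.2.2))
      - 4 * (wilsonVertex₁ e u' κ' (adM τ T Y') (P.1, (Sum.inl P.2.1, P.2.2)) (Q.1, (Sum.inr (Sum.inl Q.2.1), Q.2.2)) * ell Q.1
          + ell P.1 * wilsonVertex₁ e u' κ' (adM τ T Y') (P.1, (Sum.inr (Sum.inl P.2.1), P.2.2)) (Q.1, (Sum.inl Q.2.1, Q.2.2)))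
      - 2 * ((ell u' + ell (u' + e κ')) *
          wilsonVertex₁ e u' κ' (adM τ T (Y * Y' - Y' * Y)) (P.1, (Sum.inl P.2.1, P.2.2)) (Q.1, (Sum.inl Q.2.1, Q.2.2)))
    N P Q + N Q P = 0 := by
  intro T N
  have key := entries_of_threeForms
    (Matrix.of fun P Q : Λ × (C × D) => (∑ x : Λ, ∑ μ : D, (ell x - ell (x + e μ)) •
        (wilsonVertex₂ τ T e (u', (Sum.inr (Sum.inr 0), κ')) (x, (Sum.inr (Sum.inr 1), μ))
          + wilsonVertex₂ τ T e (x, (Sum.inr (Sum.inr 1), μ)) (u', (Sum.inr (Sum.inr 0), κ'))))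
        (P.1, (Sum.inl P.2.1, P.2.2)) (Q.1, (Sum.inl Q.2.1, Q.2.2)))
    (Matrix.of fun P Q : Λ × (C × D) => wilsonVertex₁ e u' κ' (adM τ T Y') (P.1, (Sum.inl P.2.1, P.2.2)) (Q.1, (Sum.inr (Sum.inl Q.2.1), Q.2.2)))
    (Matrix.of fun P Q : Λ × (C × D) => wilsonVertex₁ e u' κ' (adM τ T Y') (P.1, (Sum.inr (Sum.inl P.2.1), P.2.2)) (Q.1, (Sum.inl Q.2.1, Q.2.2)))
    (Matrix.of fun P Q : Λ × (C × D) => ((ell u' + ell (u' + e κ')) • wilsonVertex₁ e u' κ' (adM τ T (Y * Y' - Y' * Y)))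
        (P.1, (Sum.inl P.2.1, P.2.2)) (Q.1, (Sum.inl Q.2.1, Q.2.2)))
    (fun P : Λ × (C × D) => ell P.1) 4 4 2 (fun v => by
      have h := bgWard22_quadForm τ hτ t Y ![Y', Y] e (bondLetter u' κ' Y') ell v
      have hs : siteMul ell v = fun P : Λ × (C × D) => (fun P : Λ × (C × D) => ell P.1) P * v P := funext fun P => siteMul_apply ell v P
      rw [polHess_bondLetter, wilsonVertexOp_bondLetter, wilsonVertexOp_rot_bondLetter, quadForm_emb₀_emb₀, quadForm_emb₀_emb₁,
        quadForm_emb₁_emb₀, quadForm_emb₀_emb₀, hs] at h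
      exact h) P Q
  simpa only [N, Matrix.of_apply, Matrix.smul_apply, smul_eq_mul] using key

/-- [folklore] **THE ENTRYWISE LAW WITH THE `(2,1)` COLOUR NUMBERS EVALUATED** (an3's `wilsonVertex₁_apply_eq_mul` on the three blocks):
the conjugation block carries `τ(Y′·[t a, Y·t b − t b·Y])` (resp. `τ(Y′·[Y·t a − t a·Y, t b])`), the rotated-letter block
`τ((Y·Y′ − Y′·Y)·[t a, t b])`, all against the SAME colourless stencil `wilsonStencil₀ e u′ κ′` of the background bond; the `(2,2)` block is
the entry of the profile-weighted two-bond vertices (to be evaluated by `wilsonVertex₂_apply` under the colour trace in the sequel). -/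
theorem bgWard22_entry_colour_eval (τ : 𝔸 →ₗ[ℝ] ℝ) (hτ : ∀ a b : 𝔸, τ (a * b) = τ (b * a)) (t : C → 𝔸) (Y Y' : 𝔸) (e : D → Λ)
    (u' : Λ) (κ' : D) (ell : Λ → ℝ) (x : Λ) (a : C) (α : D) (z : Λ) (b : C) (β : D) :
    (4 * (∑ x' : Λ, ∑ μ : D, (ell x' - ell (x' + e μ)) •
          (wilsonVertex₂ τ (rotFam t Y ![Y', Y]) e (u', (Sum.inr (Sum.inr 0), κ')) (x', (Sum.inr (Sum.inr 1), μ))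
            + wilsonVertex₂ τ (rotFam t Y ![Y', Y]) e (x', (Sum.inr (Sum.inr 1), μ)) (u', (Sum.inr (Sum.inr 0), κ'))))
          (x, (Sum.inl a, α)) (z, (Sum.inl b, β))
      - 4 * (τ (Y' * br (t a) (Y * t b - t b * Y)) * wilsonStencil₀ e u' κ' (x, α) (z, β) * ell z
          + ell x * (τ (Y' * br (Y * t a - t a * Y) (t b)) * wilsonStencil₀ e u' κ' (x, α) (z, β)))
      - 2 * ((ell u' + ell (u' + e κ')) * (τ ((Y * Y' - Y' * Y) * br (t a) (t b)) * wilsonStencil₀ e u' κ' (x, α) (z, β))))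
    + (4 * (∑ x' : Λ, ∑ μ : D, (ell x' - ell (x' + e μ)) •
          (wilsonVertex₂ τ (rotFam t Y ![Y', Y]) e (u', (Sum.inr (Sum.inr 0), κ')) (x', (Sum.inr (Sum.inr 1), μ))
            + wilsonVertex₂ τ (rotFam t Y ![Y', Y]) e (x', (Sum.inr (Sum.inr 1), μ)) (u', (Sum.inr (Sum.inr 0), κ'))))
          (z, (Sum.inl b, β)) (x, (Sum.inl a, α))
      - 4 * (τ (Y' * br (t b) (Y * t a - t a * Y)) * wilsonStencil₀ e u' κ' (z, β) (x, α) * ell x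
          + ell z * (τ (Y' * br (Y * t b - t b * Y) (t a)) * wilsonStencil₀ e u' κ' (z, β) (x, α)))
      - 2 * ((ell u' + ell (u' + e κ')) * (τ ((Y * Y' - Y' * Y) * br (t b) (t a)) * wilsonStencil₀ e u' κ' (z, β) (x, α)))) = 0 := by
  have h := bgWard22_entry_colour τ hτ t Y Y' e u' κ' ell (x, (a, α)) (z, (b, β))
  simpa only [Matrix.of_apply, wilsonVertex₁_apply_eq_mul, adM_apply, rotFam_inl, rotFam_inr_inl] using h

end Entry

end Summit.QuantumFields.BalabanUV.Beta.WilsonBiStencilWardEntry
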